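import Literature.NumberTheory.EllipticCurves.KatoTwistedFinitenessQuadraticTwistEvenProofs
import Literature.NumberTheory.LFunctions.PrimitiveQuadraticCharacterKroneckerEven
import HarnessLib

/-!
# Kato's Cor. 14.3 (2) over `ℚ(ζ_M)` at every REAL Dirichlet character, from its `K = ℚ` case

K. Kato, *`p`-adic Hodge theory and values of zeta functions of modular forms*, Astérisque 295
(2004), Cor. 14.3 (2) (p. 235) — vendored for `K = ℚ(ζ_m)` as the named fact
`kato_finite_chiPart_of_twistedLValue_ne_zero` (`KatoTwistedFiniteness.lean`), with its `K = ℚ`,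
`χ = 1` case bsd.S20 (`kato_finite_of_L_one_ne_zero`, `PAdicBSD.lean`). This file assembles the
companion proof files

* `KatoTwistedFinitenessTrivialCharacterProofs` (the trivial character),
* `KatoTwistedFinitenessQuadraticTwistProofs` (quadratic characters of odd conductor),
* `KatoTwistedFinitenessQuadraticTwistEvenProofs` (quadratic characters of even conductor),

with the classification of the primitive quadratic Dirichlet characters as the Kronecker symbols
of the fundamental discriminants (Montgomery–Vaughan, Thm. 9.13; the tree's
`LFunctions/PrimitiveQuadraticCharacterKronecker{,Even}.lean`) into ONE statement:

* `kato_finite_chiPart_of_isQuadratic_of_kato_finite_of_L_one_ne_zero` — **assume bsd.S20 for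
  every elliptic curve over `ℚ`; then for `E/ℚ` elliptic with newform `f`, every `M ≥ 1` and every
  real-valued Dirichlet character `ψ` mod `M` (`ψ(a) ∈ {0, ±1}`, Mathlib `MulChar.IsQuadratic`,
  the trivial character included) such that `E` has good reduction at the primes dividing the
  conductor of `ψ`: if the mod-`M` series `∑ ψ(n) aₙ(f) n⁻ˢ` has an entire continuation
  non-vanishing at `s = 1`, then the `ψ`-part `E(ℚ(ζ_M))^(ψ)` is finite** — verbatim the
  conclusion of `kato_finite_chiPart_of_twistedLValue_ne_zero` at `(M, ψ)` (no congruence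
  condition on `M`).

Proof: `ψ = changeLevel ψ₀` for its primitive character `ψ₀` of conductor `q`
(Mathlib `changeLevel_primitiveCharacter`), which is again real-valued; `q = 1` is the trivial
character; for `q > 1`, `ψ₀(n) = (D/n)` for odd `n` with `D = ψ₀(−1) q` a fundamental
discriminant (`apply_natCast_eq_jacobiSym_sign_mul`, `isFundamentalDiscriminant_sign_mul`), and
the odd-`D` / even-`D` theorems of the companion files apply (`ψ₀ = (·/q)` for odd `D` by
reciprocity).

So the real characters (with the good-reduction proviso at the conductor) are the part of Kato's
corollary over cyclotomic fields reached here from its `K = ℚ` case for elliptic curves (equally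
from Gross–Zagier–Kolyvagin); for a complex character `χ` (order `≥ 3`) the twisted object
`E ⊗ χ` is no longer an elliptic curve over `ℚ`, and Kato's Euler system (Thm. 14.2) is the road.
Everything here is a theorem; no definition and no named fact is introduced; bsd.S20 enters as
the hypothesis `hS20`.

## Scope (what is not covered)

* Real characters with a prime of bad reduction of `E` in the conductor.
* Complex characters; the Selmer-group clause, part (1) of Cor. 14.3.

## References

* K. Kato, Astérisque 295 (2004), Thm. 14.2, Cor. 14.3 (p. 235), 14.5–14.7 (p. 237).
  [Kato2004Asterisque]
* H. L. Montgomery, R. C. Vaughan, *Multiplicative Number Theory I* (2007), Thm. 9.13.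
  [MontgomeryVaughan2007]
-/

noncomputable section

open scoped BigOperators NumberTheorySymbols

open WeierstrassCurve WeierstrassCurve.Affine CongruenceSubgroup Complex

namespace Literature.NumberTheory.EllipticCurves

/-! ## 1. Real-valuedness descends to the primitive character -/

section Descent

variable {M q : ℕ} [NeZero M]

/-- If the inflation `changeLevel ψ₀` mod `M` of a character `ψ₀` mod `q ∣ M` is real-valued
(`IsQuadratic`), so is `ψ₀` (every unit mod `q` lifts to a unit mod `M`,
Mathlib `ZMod.unitsMap_surjective`). [folklore] -/
theorem isQuadratic_of_isQuadratic_changeLevel (hd : q ∣ M) {ψ₀ : DirichletCharacter ℂ q}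
    (h : (DirichletCharacter.changeLevel hd ψ₀).IsQuadratic) : ψ₀.IsQuadratic := by
  intro a
  by_cases ha : IsUnit a
  · obtain ⟨U, hU⟩ := ZMod.unitsMap_surjective hd ha.unit
    have hval : DirichletCharacter.changeLevel hd ψ₀ (U : ZMod M) = ψ₀ a := by
      rw [DirichletCharacter.changeLevel_eq_cast_of_dvd ψ₀ hd U, ← ZMod.unitsMap_val hd U, hU,
        IsUnit.unit_spec]
    rw [← hval]
    exact h _
  · exact Or.inl (MulChar.map_nonunit ψ₀ ha)

end Descent

/-! ## 2. Kato's Cor. 14.3 (2) at every real character mod `M`, from bsd.S20 -/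

section RealCharacters

open ModularForms QuadraticFields IsDedekindDomain NumberField Rat.HeightOneSpectrum
  Literature.NumberTheory.LFunctions.PrimitiveQuadratic

variable {M : ℕ} [NeZero M]

/-- `(s q/·)`-values for odd arguments identify a character mod odd `q` with the Jacobi character
`(·/q)` when `s q ≡ 1 (mod 4)` (`s = ±1`): every unit class mod `q` has an odd representative
`r`, and `(s q/r) = (r/q)` (reciprocity, `jacobiSym_natAbs_eq_of_emod_four_eq_one`). [folklore] -/
theorem eq_jacobiChar_of_forall_odd {q : ℕ} [NeZero q] (hqodd : Odd q) {D : ℤ} (hD4 : D % 4 = 1)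
    (hDq : D.natAbs = q) {ψ₀ : DirichletCharacter ℂ q}
    (hval : ∀ n : ℕ, Odd n → ψ₀ (n : ZMod q) = (J(D | n) : ℂ)) : ψ₀ = jacobiChar q := by
  refine MulChar.ext fun u => ?_
  obtain ⟨r, hr, hru⟩ : ∃ r : ℕ, Odd r ∧ (r : ZMod q) = u := by
    by_cases hpar : Odd (u : ZMod q).val
    · exact ⟨_, hpar, ZMod.natCast_zmod_val _⟩
    · refine ⟨(u : ZMod q).val + q, (Nat.not_odd_iff_even.mp hpar).add_odd hqodd, ?_⟩
      rw [Nat.cast_add, ZMod.natCast_self, add_zero, ZMod.natCast_zmod_val]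
  rw [← hru, hval r hr, jacobiChar_natCast, ← hDq, jacobiSym_natAbs_eq_of_emod_four_eq_one hD4 hr]

set_option backward.isDefEq.respectTransparency false in
/-- **Kato's Cor. 14.3 (2) over `ℚ(ζ_M)` at every real Dirichlet character, from bsd.S20 for the
quadratic twists.** Assume `kato_finite_of_L_one_ne_zero V p` (bsd.S20: `L(V, 1) ≠ 0 ⇒ V(ℚ)`
finite — Kato Cor. 14.3 with `K = ℚ`, `χ = 1`, equally Gross–Zagier–Kolyvagin) for every elliptic
`V/ℚ` and prime `p`. Let `E/ℚ` be an elliptic curve (model `W`) with newform `f`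
(`IsNewformOf W f`), `M ≥ 1`, and `ψ` a real-valued Dirichlet character mod `M` (`ψ(a) ∈ {0, ±1}`)
such that `E` has good reduction at every prime dividing the conductor of `ψ`. If the mod-`M`
series `∑ ψ(n) aₙ(f) n⁻ˢ` (`twistedLSeries f ψ`) has an entire continuation non-vanishing at
`s = 1`, then the `ψ`-part `E(ℚ(ζ_M))^(ψ)` of the Mordell–Weil group (Kato's `M^(χ)`, the tree's
`chiPart`, for `ψ` read on `Gal(ℚ(ζ_M)/ℚ) ≅ (ℤ/M)ˣ` by `cyclotomicCharacterOf`) is finite — the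
statement of `kato_finite_chiPart_of_twistedLValue_ne_zero` at `(M, ψ)`. Cases on the primitive
character `ψ₀` of `ψ` (conductor `q`): `q = 1` — the trivial character
(`kato_finite_chiPart_cyclotomic_one_of_kato_finite_of_L_one_ne_zero`); `q > 1` — `ψ₀ = (D/·)` on
odd arguments with `D = ψ₀(−1) q` a fundamental discriminant (Montgomery–Vaughan Thm. 9.13:
`apply_natCast_eq_jacobiSym_sign_mul`, `isFundamentalDiscriminant_sign_mul`); odd `D`:
`ψ₀ = (·/q)` and `kato_finite_chiPart_changeLevel_jacobiChar_of_kato_finite_of_L_one_ne_zero`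
(twist `E^{(q*)}`); even `D = 4m`:
`kato_finite_chiPart_changeLevel_kronecker_of_kato_finite_of_L_one_ne_zero` (twist `E^{(4m)}`).
[cite: Kato2004Asterisque, Cor. 14.3 (2) (p. 235)] -/
theorem kato_finite_chiPart_of_isQuadratic_of_kato_finite_of_L_one_ne_zero
    (hS20 : ∀ (V : WeierstrassCurve ℚ) [V.IsElliptic] (p : ℕ) [Fact p.Prime],
      kato_finite_of_L_one_ne_zero V p)
    (W : WeierstrassCurve ℚ) [W.IsElliptic] {N : ℕ} [NeZero N] {f : CuspForm (Gamma0 N) 2}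
    (hf : IsNewformOf W f) [DecidableEq (CyclotomicField M ℚ)]
    (ψ : DirichletCharacter ℂ M) (hψ : ψ.IsQuadratic)
    (hgood : ∀ v : HeightOneSpectrum (𝓞 ℚ), (primesEquiv v : ℕ) ∣ ψ.conductor →
      W.HasGoodReductionAt v)
    (hL : ∃ L : ℂ → ℂ, Differentiable ℂ L ∧
      (∀ s : ℂ, 2 < s.re → L s = twistedLSeries f ψ s) ∧ L 1 ≠ 0) :
    Finite (chiPart
      (fun σ : CyclotomicField M ℚ ≃ₐ[ℚ] CyclotomicField M ℚ =>
        Point.map (W' := W.toAffine) (σ : CyclotomicField M ℚ →ₐ[ℚ] CyclotomicField M ℚ))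
      (fun σ => (cyclotomicCharacterOf ψ σ : ℂ))) := by
  -- `ψ = changeLevel ψ₀` for its primitive character `ψ₀` of conductor `q`
  obtain ⟨q, hq, ψ₀, hprim, hcq, hψeq⟩ : ∃ (q : ℕ) (hq : q ∣ M) (ψ₀ : DirichletCharacter ℂ q),
      ψ₀.IsPrimitive ∧ ψ.conductor = q ∧ DirichletCharacter.changeLevel hq ψ₀ = ψ :=
    ⟨ψ.conductor, ψ.conductor_dvd_level, ψ.primitiveCharacter,
      DirichletCharacter.primitiveCharacter_isPrimitive ψ, rfl,
      DirichletCharacter.changeLevel_primitiveCharacter ψ⟩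
  subst hψeq
  haveI : NeZero q := ⟨fun h => NeZero.ne M (Nat.eq_zero_of_zero_dvd (h ▸ hq))⟩
  have hquad : ψ₀.IsQuadratic := isQuadratic_of_isQuadratic_changeLevel hq hψ
  have hgood' : ∀ v : HeightOneSpectrum (𝓞 ℚ), (primesEquiv v : ℕ) ∣ q →
      W.HasGoodReductionAt v := fun v hv => hgood v (by rwa [hcq])
  rcases Nat.lt_or_ge 1 q with h1 | h1
  · -- `q > 1`: `ψ₀ = (D/·)` at odd arguments, `D = ψ₀(-1) q` fundamental
    obtain ⟨s, hs1, hs⟩ := exists_sign_eq ψ₀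
    have hs1' : s = 1 ∨ s = -1 := by
      rcases hs1 with ⟨h, -⟩ | ⟨h, -⟩
      · exact Or.inl h
      · exact Or.inr h
    have hsabs : s.natAbs = 1 := by rcases hs1' with rfl | rfl <;> rfl
    have hDq : (s * q : ℤ).natAbs = q := by rw [Int.natAbs_mul, hsabs, one_mul, Int.natAbs_natCast]
    have hval : ∀ n : ℕ, Odd n → ψ₀ (n : ZMod q) = (J(s * q | n) : ℂ) := fun n hn =>
      apply_natCast_eq_jacobiSym_sign_mul hprim hquad hs hs1' hn
    rcases isFundamentalDiscriminant_sign_mul hprim hquad hs hs1' h1 with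
      ⟨hD4, hsqD, -⟩ | ⟨h4, hm4, hsqm⟩
    · -- odd discriminant `D = s q`: `q` odd squarefree, `ψ₀ = (·/q)`
      have hqodd : Odd q := by
        rw [← hDq, Int.natAbs_odd, Int.odd_iff]
        omega
      have hsq : Squarefree q := by
        rw [← hDq, Int.squarefree_natAbs]
        exact hsqD
      have hq1 : q ≠ 1 := by omega
      have hψ₀ : ψ₀ = jacobiChar q := eq_jacobiChar_of_forall_odd hqodd hD4 hDq hval
      subst hψ₀
      exact kato_finite_chiPart_changeLevel_jacobiChar_of_kato_finite_of_L_one_ne_zero hS20 W hf hq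
        hqodd hsq hq1 hgood' hL
    · -- even discriminant `D = s q = 4m`
      obtain ⟨m, hDm⟩ := h4
      have hdiv : (s * q : ℤ) / 4 = m := by rw [hDm, Int.mul_ediv_cancel_left _ four_ne_zero]
      rw [hdiv] at hm4 hsqm
      have hqm : q = 4 * m.natAbs := by
        have h := congrArg Int.natAbs hDm
        rw [hDq, Int.natAbs_mul] at h
        exact h
      have hχ : ∀ n : ℕ, Odd n → ψ₀ (n : ZMod q) = (J(m | n) : ℂ) := fun n hn => by
        rw [hval n hn, hDm, jacobiSym.mul_left, jacobiSym.at_four hn, one_mul]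
      have hgood'' : ∀ v : HeightOneSpectrum (𝓞 ℚ), ((primesEquiv v : ℕ) : ℤ) ∣ 4 * m →
          W.HasGoodReductionAt v := fun v hv =>
        hgood' v (by
          rw [← hDm] at hv
          have h := Int.natAbs_dvd_natAbs.mpr hv
          rwa [Int.natAbs_natCast, hDq] at h)
      exact kato_finite_chiPart_changeLevel_kronecker_of_kato_finite_of_L_one_ne_zero hS20 W hf hm4
        hsqm hqm hq hχ hgood'' hL
  · -- `q = 1`: `ψ₀ = 1`, the trivial character mod `M`
    have hq1 : q = 1 := by
      have := NeZero.pos q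
      omega
    subst hq1
    have hψ₀ : ψ₀ = 1 := ψ₀.level_one
    subst hψ₀
    rw [map_one] at hL ⊢
    exact kato_finite_chiPart_cyclotomic_one_of_kato_finite_of_L_one_ne_zero hS20 W hf hL

end RealCharacters

end Literature.NumberTheory.EllipticCurves

end
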